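import Literature.Algebra.Homology.OrderedCechMapNonempty
import Literature.Algebra.Homology.HomologySequenceTauOne
import Literature.Algebra.Homology.HomologySequenceTauTwo
import HarnessLib

/-!
# Comparison of short exact sequences of ordered Čech complexes: Serre's dévissage step

Serre, *GAGA* n° 13, proves Théorème 1 (`H^q(X, 𝓕) ≅ H^q(X^h, 𝓕^h)`) for every coherent sheaf from
the case of the twisting sheaves by DÉVISSAGE: an exact sequence of sheaves `0 → 𝓐 → 𝓑 → 𝓒 → 0`
gives two long exact cohomology sequences (algebraic and analytic) and a commutative ladder between
them, and "en appliquant le lemme des cinq" the comparison theorem for two of `𝓐, 𝓑, 𝓒` gives it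
for the third. In the tree's Čech language (sections of all sheaves over the pieces `U_s` of ONE
finite affine cover living in ambient modules, `Literature/Algebra/Homology/OrderedCech`,
`OrderedCechMap`) this file packages that step once and for all:

* (from the tree, `OrderedCechMapNonempty`, not restated) `OrderedCech.shortExact_familySC_of_nonempty`
  — the short complex of ordered Čech complexes `Č(E) → Č(F) → Č(G)` attached to linear maps `φ`, `ψ`
  of the ambient modules (`OrderedCech.familySC`) is SHORT EXACT as soon as `0 → E s → F s → G s → 0`
  is exact for every NONEMPTY `s` (the ordered Čech complex only sees nonempty simplices; exactness
  at `s = ∅` fails for global sections in every interesting case, e.g.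
  `Γ(ℙ_r, 𝒪(-1)^{r+1}) → Γ(ℙ_r, 𝒪)`) — this is the hypothesis `h`, `h'` below;
* `OrderedCech.familySCMap` — the morphism of such short complexes induced by three linear maps
  `a, b, c` of ambient modules commuting with `φ, ψ` on the members (the ladder);
* **`OrderedCech.quasiIso₃_of_shortExact`, `quasiIso₁_of_shortExact`, `quasiIso₂_of_shortExact`** —
  if two of the three comparison maps `Č(E) → Č(E')`, `Č(F) → Č(F')`, `Č(G) → Č(G')` are
  quasi-isomorphisms, so is the third (Mathlib `HomologySequence.quasiIso_τ₃`, the tree's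
  `Literature.Algebra.Homology.quasiIso_τ₁` of `HomologySequenceTauOne` and `quasiIso_τ₂` of
  `HomologySequenceTauTwo`; Weibel Thm. 1.3.1 + Ex. 1.3.3).

The Koszul case (kernels of the exterior powers of the Euler sequence) is
`OrderedCechKoszulKernels`; the present general form is what the next dévissage steps (ideal-sheaf
sequences `0 → 𝓘_X(n) → 𝒪(n) → 𝒪_X(n) → 0`, conormal sequences) consume. Related in the tree (not
restated): `OrderedCechPieces` (`pieceSC(NE)`, `shortExact_pieceSC(NE)`: MEMBERWISE maps and a
sub-cover, for Grothendieck's finiteness dévissage — no comparison ladder, no quasi-isomorphism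
statements). Everything is proved; no named facts.

## References
* [SerreGAGA1956] J.-P. Serre, *Géométrie algébrique et géométrie analytique*, Ann. Inst. Fourier 6
  (1956), n° 13 (the dévissage: "on a un diagramme commutatif … en appliquant le lemme des cinq").
* [Weibel1994] C. A. Weibel, *An Introduction to Homological Algebra* (1994), Thm. 1.3.1, Ex. 1.3.3.
* [GortzWedhorn2023] U. Görtz, T. Wedhorn, *Algebraic Geometry II*, (21.14)–(21.15), Def. 21.68.
-/

noncomputable section

universe u v

open CategoryTheory Finset

namespace Literature.Algebra.Homology

namespace OrderedCech

variable {ι : Type} [LinearOrder ι] {A : Type u} [CommRing A]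
variable {𝕂₁ 𝕂₂ 𝕂₃ : Type v} [AddCommGroup 𝕂₁] [Module A 𝕂₁] [AddCommGroup 𝕂₂] [Module A 𝕂₂]
  [AddCommGroup 𝕂₃] [Module A 𝕂₃]
variable {E : Finset ι → Submodule A 𝕂₁} {F : Finset ι → Submodule A 𝕂₂}
  {G : Finset ι → Submodule A 𝕂₃} (hE : Monotone E) (hF : Monotone F) (hG : Monotone G)
variable (φ : 𝕂₁ →ₗ[A] 𝕂₂) (hφ : ∀ s, ∀ x ∈ E s, φ x ∈ F s) (ψ : 𝕂₂ →ₗ[A] 𝕂₃)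
  (hψ : ∀ s, ∀ x ∈ F s, ψ x ∈ G s) (hcomp : ∀ s, ∀ x ∈ E s, ψ (φ x) = 0)

/-! ### The ladder and the two-out-of-three statements -/

variable {𝕂₁' 𝕂₂' 𝕂₃' : Type v} [AddCommGroup 𝕂₁'] [Module A 𝕂₁'] [AddCommGroup 𝕂₂'] [Module A 𝕂₂']
  [AddCommGroup 𝕂₃'] [Module A 𝕂₃']
variable {E' : Finset ι → Submodule A 𝕂₁'} {F' : Finset ι → Submodule A 𝕂₂'}
  {G' : Finset ι → Submodule A 𝕂₃'} (hE' : Monotone E') (hF' : Monotone F') (hG' : Monotone G')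
variable (φ' : 𝕂₁' →ₗ[A] 𝕂₂') (hφ' : ∀ s, ∀ x ∈ E' s, φ' x ∈ F' s) (ψ' : 𝕂₂' →ₗ[A] 𝕂₃')
  (hψ' : ∀ s, ∀ x ∈ F' s, ψ' x ∈ G' s) (hcomp' : ∀ s, ∀ x ∈ E' s, ψ' (φ' x) = 0)
variable (a : 𝕂₁ →ₗ[A] 𝕂₁') (ha : ∀ s, ∀ x ∈ E s, a x ∈ E' s) (b : 𝕂₂ →ₗ[A] 𝕂₂')
  (hb : ∀ s, ∀ x ∈ F s, b x ∈ F' s) (c : 𝕂₃ →ₗ[A] 𝕂₃') (hc : ∀ s, ∀ x ∈ G s, c x ∈ G' s)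
  (hab : ∀ s, ∀ x ∈ E s, b (φ x) = φ' (a x)) (hbc : ∀ s, ∀ x ∈ F s, c (ψ x) = ψ' (b x))

/-- **The ladder**: three linear maps `a, b, c` of ambient modules carrying members to members and
commuting with `φ, ψ` on the members induce a morphism between the short complexes of ordered Čech
complexes (Serre's commutative diagram of n° 13). [cite: SerreGAGA1956, n° 13] -/
def familySCMap :
    familySC ψ hψ hF hG hE φ hφ hcomp ⟶ familySC ψ' hψ' hF' hG' hE' φ' hφ' hcomp' :=
  ShortComplex.homMk (complexMap a ha hE hE') (complexMap b hb hF hF') (complexMap c hc hG hG')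
    (by
      ext n g
      change Cochain.map φ' hφ' n (Cochain.map a ha n g) = Cochain.map b hb n (Cochain.map φ hφ n g)
      funext σ; apply Subtype.ext
      simp only [Cochain.coe_map_apply]
      exact (hab σ.1 _ (g σ).2).symm)
    (by
      ext n g
      change Cochain.map ψ' hψ' n (Cochain.map b hb n g) = Cochain.map c hc n (Cochain.map ψ hψ n g)
      funext σ; apply Subtype.ext
      simp only [Cochain.coe_map_apply]
      exact (hbc σ.1 _ (g σ).2).symm)

/-- The components of the ladder. [cite: SerreGAGA1956, n° 13] -/
@[simp] theorem familySCMap_τ₁ :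
    (familySCMap hE hF hG φ hφ ψ hψ hcomp hE' hF' hG' φ' hφ' ψ' hψ' hcomp' a ha b hb c hc hab hbc).τ₁ =
      complexMap a ha hE hE' := rfl

/-- See `familySCMap_τ₁`. [cite: SerreGAGA1956, n° 13] -/
@[simp] theorem familySCMap_τ₂ :
    (familySCMap hE hF hG φ hφ ψ hψ hcomp hE' hF' hG' φ' hφ' ψ' hψ' hcomp' a ha b hb c hc hab hbc).τ₂ =
      complexMap b hb hF hF' := rfl

/-- See `familySCMap_τ₁`. [cite: SerreGAGA1956, n° 13] -/
@[simp] theorem familySCMap_τ₃ :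
    (familySCMap hE hF hG φ hφ ψ hψ hcomp hE' hF' hG' φ' hφ' ψ' hψ' hcomp' a ha b hb c hc hab hbc).τ₃ =
      complexMap c hc hG hG' := rfl

include hab hbc in
/-- **Dévissage, third term**: if both sequences of families are short exact on nonempty members and
the comparison maps on `Č(E)` and `Č(F)` are quasi-isomorphisms, so is the one on `Č(G)` (the two
long exact sequences and the five lemma, Mathlib `HomologySequence.quasiIso_τ₃`).
[cite: SerreGAGA1956, n° 13] [cite: Weibel1994, Thm. 1.3.1 and Ex. 1.3.3] -/
theorem quasiIso₃_of_shortExact (h : (familySC ψ hψ hF hG hE φ hφ hcomp).ShortExact)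
    (h' : (familySC ψ' hψ' hF' hG' hE' φ' hφ' hcomp').ShortExact)
    (h₁ : QuasiIso (complexMap a ha hE hE')) (h₂ : QuasiIso (complexMap b hb hF hF')) :
    QuasiIso (complexMap c hc hG hG') :=
  HomologicalComplex.HomologySequence.quasiIso_τ₃
    (familySCMap hE hF hG φ hφ ψ hψ hcomp hE' hF' hG' φ' hφ' ψ' hψ' hcomp' a ha b hb c hc hab hbc) h h'
    h₁ h₂

include hab hbc in
/-- **Dévissage, first term**: if the comparison maps on `Č(F)` and `Č(G)` are quasi-isomorphisms,
so is the one on `Č(E)` (the tree's `quasiIso_τ₁` of `HomologySequenceTauOne`). [cite: SerreGAGA1956, n° 13]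
[cite: Weibel1994, Thm. 1.3.1 and Ex. 1.3.3] -/
theorem quasiIso₁_of_shortExact (h : (familySC ψ hψ hF hG hE φ hφ hcomp).ShortExact)
    (h' : (familySC ψ' hψ' hF' hG' hE' φ' hφ' hcomp').ShortExact)
    (h₂ : QuasiIso (complexMap b hb hF hF')) (h₃ : QuasiIso (complexMap c hc hG hG')) :
    QuasiIso (complexMap a ha hE hE') :=
  Literature.Algebra.Homology.quasiIso_τ₁
    (familySCMap hE hF hG φ hφ ψ hψ hcomp hE' hF' hG' φ' hφ' ψ' hψ' hcomp' a ha b hb c hc hab hbc) h h'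
    h₂ h₃

include hab hbc in
/-- **Dévissage, middle term**: if the comparison maps on `Č(E)` and `Č(G)` are quasi-isomorphisms,
so is the one on `Č(F)` (`quasiIso_τ₂` of `HomologySequenceTauTwo`). [cite: SerreGAGA1956, n° 13]
[cite: Weibel1994, Thm. 1.3.1 and Ex. 1.3.3] -/
theorem quasiIso₂_of_shortExact (h : (familySC ψ hψ hF hG hE φ hφ hcomp).ShortExact)
    (h' : (familySC ψ' hψ' hF' hG' hE' φ' hφ' hcomp').ShortExact)
    (h₁ : QuasiIso (complexMap a ha hE hE')) (h₃ : QuasiIso (complexMap c hc hG hG')) :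
    QuasiIso (complexMap b hb hF hF') :=
  Literature.Algebra.Homology.quasiIso_τ₂
    (familySCMap hE hF hG φ hφ ψ hψ hcomp hE' hF' hG' φ' hφ' ψ' hψ' hcomp' a ha b hb c hc hab hbc) h h'
    h₁ h₃

end OrderedCech

end Literature.Algebra.Homology
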